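import Summits.QuantumFields.BalabanUV.Beta.FP.TowerFAnchorRow

/-!
# `BalabanUV.Beta.FP.TowerFAnchorRowW` — road «FP», binder row D1, ROUTE T, the (H5-F) option (3a) (road `g61/JUNCTION-F.md` §3 (3); an2 g84 RCPT-4 ∕ W-8): **THE END's
# DEPTH-1 ANCHOR ROW `hF₁` (AND `hVF hWF hδF` AT STOREY 0) FOR ANY EXPONENTIALLY LOCALISED STEP WEIGHT FAMILY** — `TowerFAnchorRow` §3–§4 (road g58, p738058) with
# `wStep Lc 1 ↦ w 0` for `(w : ℕ → EKer 4)` displayed with the ONE letter `hwloc` (the shape of g58's `abs_wStep_le`); the sibling of `FP/TowerFTransportRowW` (storeys ≥ 1)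

WHY (journal l.69153 an2 RCPT-4 (3a), l.69163∕69167 W-8∕W-10; road A-4 l.69160, STAGED-6 l.69169).  Option (3a) dresses the END's F-family at EVERY storey, the anchor included
(`𝒱F 1 := σ′₀•(Lc⁴ • dressV Lc Lc (w 0) (vertexOfK (GcombSh Lc 0) …))`), by the true weight `wFRec` (an2 PART 96); g58's anchor proof uses `wStep Lc 1` ONLY through
`abs_wStep_le Lc 1`, so THIS FILE displays that letter generically and repeats §3–§4 token for token (generator: `wStep Lc 1 ↦ w 0` ×N, `abs_wStep_le Lc 1 ↦ hwloc 0` ×2, names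
`… ↦ …_w`; §1∕§2 of g58 — the literal's level-0 letters and the storey-1 chart letters — are weight-free and imported BY NAME).  With `w 0 := wFRec … 0` the END consumer's `hF₁`
(literal: `dressedEntry (wStep Lc 1) (TshotOf … 1)`) follows from `hF₁_rec_w` and the displayed dressing-invariance junction `hWT 0`.

WHAT ([folklore] composition BY NAME; no `def`, no `def … : Prop`, nothing cited, 0 sorry): §1 **`exists_vertexFamilies_FRec_zero_w`**; §2 **`hF₁_rec_w`**.
WHAT THIS IS NOT: not the weight, not `hWT`; storey 0 keeps FP-64's chart seam (`hLF₀`) under v11-R — untouched here; nothing of Bałaban's asserted, valued or discharged; 0 estimates;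
0∕4 row-D1 binders (hW, hR, D1Tel, D1Rep); NOT (C1), NOT (T-ID), NOT D1, NEVER «G-an2-4 closed», NOT BetaPertH, NOT continuum, NOT Clay.

HONEST DEPENDENCY (page 1, mandatory): continuum YM on T⁴ ⇐ BetaPertH ∧ nine spine estimates (0/9 proved); BetaPertH ⇐ (D1) ∧ (D4) ∧ CAP+tail;
G-an2-4 gates asym, D1 and NE2/3/4.  HONEST FRAMING (cell contract, verbatim): «discharging `BetaPertH` makes Bałaban's UV stability UNCONDITIONAL —
a real constructive-QFT result; it is NOT the continuum limit and NOT the Clay problem.»  ABSOLUTE RULE (cell charter, verbatim): «No internally-minted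
statement may enter as a cited fact. Every hypothesis is either kernel-proved in this package or a verbatim quotation of a PUBLISHED theorem with page
reference. The manuscript(s) under audit are NOT citable for their own disputed steps — they are the thing under adjudication; programme-internal
(2001/route/tribunal) claims are never citable.»  Road «FP» OWNER, b2b-balaban-beta-d1-p3 gen 61, 2026-08-30.  No existing file touched.
-/

noncomputable section

open scoped BigOperators

namespace Summit.QuantumFields.BalabanUV.Beta.FP.TowerFAnchorRowW

open Matrix Finset
open Literature.MathematicalPhysics.QuantumFieldTheory
open Literature.MathematicalPhysics.QuantumFieldTheory.Balaban1983to89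
open Literature.MathematicalPhysics.QuantumFieldTheory.Balaban1983to89.Beta
open B5Prop11Plancherel (fine)
open B12Sec2to5 (l1)
open AffineAveraging (Site box toSite)
open AveragingContoursRooted (ctr ctrOff)
open OneStepResolventKernel (Fib biLoc_mono)
open OneStepKernelFamily (vertexOfK TshotOf vertexFamily_vertexOfK')
open ExpKernelCalculus (MKer Decays BiLoc VertexFamily VertexFamily₂ shiftK hessKer bubble tadpole)
open DressedMomentNormalisation (EKer dressedEntry)
open HessKerRate (scaleK hessKer_scaleK biLoc_scaleK decays_scaleK)
open SecondOrderResponse (biLoc_smul)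
open KernelReflection (bubble_smul_left bubble_smul_right tadpole_smul)
open HessianTelescopingKKT (wStep)
open BalabanStepJets (vertexFamily₂_mono)
open BalabanStepJetsSucc (vertexOfK_translate_block)
open Summit.QuantumFields.BalabanUV.Beta.TameKernelCalculus (Spr biLoc_of_le)
open Summit.QuantumFields.BalabanUV.Beta.AxialDressingRooted (axEc)
open Summit.QuantumFields.BalabanUV.Beta.SymSecondOrderTablesAn1 (symTablesAn1S2)
open Summit.QuantumFields.BalabanUV.Beta.CombChartStepJets (GcombSh decays_GcombSh shiftK_GcombSh JsB12CombSh0 JsB12CombSh0_S_translate JsB12CombSh0_W_translate)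
open Summit.QuantumFields.BalabanUV.Beta.CombChartJointEnd (TbalOf_JsB12CombShSym)
open Summit.QuantumFields.BalabanUV.Beta.CompositeOneShotJetData (Roots Pins JcComp TshotOf_JcComp_one)
open Summit.QuantumFields.BalabanUV.Beta.FP.KernelPeriodisationFib (Idx perF)
open Summit.QuantumFields.BalabanUV.Beta.FP.TorusCompositeObjects (towerTorus)
open Summit.QuantumFields.BalabanUV.Beta.FP.TowerNAxialLetters (perF_rules_scaleK)
open Summit.QuantumFields.BalabanUV.Beta.FP.PackedLegCombSym (perF_rules_combSym)
open Summit.QuantumFields.BalabanUV.Beta.FP.RelInvPeriodisedComb (shiftK_GcombSh')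
open Summit.QuantumFields.BalabanUV.Beta.FP.TowerSigmaLegLetters (shiftK_scaleK abs_fibSigma'_le)
open Summit.QuantumFields.BalabanUV.Beta.FP.NestedConstraintScaling (fibreScale_mul_inv)
open Summit.QuantumFields.BalabanUV.Beta.FP.KernelStepDressing (dressV dressW vertexFamily_dressV vertexFamily₂_dressW)
open Summit.QuantumFields.BalabanUV.Beta.FP.KernelStepDressingHessKer (hessKer_dressV_dressW)
open Summit.QuantumFields.BalabanUV.Beta.FP.TowerFAnchorRow (VG0_translate vertexFamilies_G0)

/-! ## §1 The `w 0`-dressed literal families ARE vertex families at blocking `Lc·Lc` (`∃`-form) -/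

section Families

variable (Lc : ℕ) [NeZero Lc] (hLc : Odd Lc) (N : ℕ) (cΛ cB : ℝ) (uF : ℕ → ℝ) (w : ℕ → EKer (3 + 1))
  (hwloc : ∀ j : ℕ, ∃ δ C : ℝ, 0 < δ ∧ 0 ≤ C ∧ ∀ (κ l : Fin (3 + 1)) (p : Fin (3 + 1) → ℤ), |w j κ l p| ≤ C * Real.exp (-δ * l1 p))

include hwloc in
/-- [folklore] **THE σ′₀-SCALED `w 0`-DRESSED LITERAL FAMILIES ARE VERTEX FAMILIES** at blocking `Lc·Lc` (`TowerFAnchorRow.exists_vertexFamilies_FRec_zero` with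
`wStep Lc 1 ↦ w 0`, `abs_wStep_le Lc 1 ↦ hwloc 0`; §1's `vertexFamilies_G0` by name). -/
theorem exists_vertexFamilies_FRec_zero_w (huF : 1 ≤ uF 0) : ∃ Cv Cw δ : ℝ, 0 < δ ∧
    VertexFamily (fun μ y => scaleK (Sum.elim (fun _ : Fin (3 + 1) => (1 : ℝ)) (fun _ : Fin (3 + 1) => (uF 0))) (Sum.elim (fun _ : Fin (3 + 1) => (1 : ℝ)) (fun _ : Fin (3 + 1) => (uF 0))) ((Lc : ℝ) ^ 4 • dressV Lc Lc (w 0) (vertexOfK (GcombSh (d := 3) Lc 0) Lc (JsB12CombSh0 hLc N (symTablesAn1S2 3 Lc cΛ) cΛ cB 0).S) μ y)) (Lc * Lc) Cv δ ∧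
    VertexFamily₂ (fun μ y ν y' => scaleK (Sum.elim (fun _ : Fin (3 + 1) => (1 : ℝ)) (fun _ : Fin (3 + 1) => (uF 0))) (Sum.elim (fun _ : Fin (3 + 1) => (1 : ℝ)) (fun _ : Fin (3 + 1) => (uF 0))) ((Lc : ℝ) ^ 8 • dressW Lc Lc (w 0) (JsB12CombSh0 hLc N (symTablesAn1S2 3 Lc cΛ) cΛ cB 0).W μ y ν y')) (Lc * Lc) Cw δ := by
  obtain ⟨Cv, Cw, δ, hδ, hV, hW⟩ := vertexFamilies_G0 Lc hLc N cΛ cB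
  obtain ⟨δw, Cw0, hδw, hCw0, hw⟩ := hwloc 0
  have hV' := vertexFamily_dressV (N := Lc) Lc (w := w 0) (fun c a u => hw c a u) hCw0 hδw hV hδ
  have hW' := vertexFamily₂_dressW (N := Lc) Lc (w := w 0) (fun c a u => hw c a u) hCw0 hδw hW hδ
  have hNpos : (0 : ℝ) < ((Lc : ℕ) : ℝ) := by exact_mod_cast Nat.pos_of_ne_zero (NeZero.ne Lc)
  have hm : 0 < min (δw / ((Lc : ℕ) : ℝ)) δ := lt_min (div_pos hδw hNpos) hδ
  have hs := fun a => abs_fibSigma'_le (d := 3) huF a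
  have hle : min (δw / ((Lc : ℕ) : ℝ)) δ / 2 / 2 ≤ min (δw / ((Lc : ℕ) : ℝ)) δ / 2 := by linarith [half_pos hm]
  have hV'' : VertexFamily (fun μ y => scaleK (Sum.elim (fun _ : Fin (3 + 1) => (1 : ℝ)) (fun _ : Fin (3 + 1) => (uF 0)))
      (Sum.elim (fun _ : Fin (3 + 1) => (1 : ℝ)) (fun _ : Fin (3 + 1) => (uF 0)))
      ((Lc : ℝ) ^ 4 • dressV Lc Lc (w 0) (vertexOfK (GcombSh (d := 3) Lc 0) Lc (JsB12CombSh0 hLc N (symTablesAn1S2 3 Lc cΛ) cΛ cB 0).S) μ y)) (Lc * Lc)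
      (uF 0 * (|(Lc : ℝ) ^ 4| * |∑ _c : Fin (3 + 1), Cw0 * |Cv| * ExpKernelCalculus.Zl (3 + 1) (min (δw / ((Lc : ℕ) : ℝ)) δ / 2)|) * uF 0)
      (min (δw / ((Lc : ℕ) : ℝ)) δ / 2 / 2) :=
    fun μ y => biLoc_scaleK hs hs (biLoc_smul ((Lc : ℝ) ^ 4) (biLoc_of_le (hV' μ y) hle))
  have hW'' : VertexFamily₂ (fun μ y ν y' => scaleK (Sum.elim (fun _ : Fin (3 + 1) => (1 : ℝ)) (fun _ : Fin (3 + 1) => (uF 0)))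
      (Sum.elim (fun _ : Fin (3 + 1) => (1 : ℝ)) (fun _ : Fin (3 + 1) => (uF 0)))
      ((Lc : ℝ) ^ 8 • dressW Lc Lc (w 0) (JsB12CombSh0 hLc N (symTablesAn1S2 3 Lc cΛ) cΛ cB 0).W μ y ν y')) (Lc * Lc)
      (uF 0 * (|(Lc : ℝ) ^ 8| * (∑ _c : Fin (3 + 1), ∑ _e : Fin (3 + 1),
        Cw0 * (Cw0 * |Cw| * ExpKernelCalculus.Zl (3 + 1) (min (δw / ((Lc : ℕ) : ℝ)) δ / 2))
          * ExpKernelCalculus.Zl (3 + 1) (min (δw / ((Lc : ℕ) : ℝ)) δ / 2 / 2))) * uF 0)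
      (min (δw / ((Lc : ℕ) : ℝ)) δ / 2 / 2) :=
    fun μ y ν y' => biLoc_scaleK hs hs (biLoc_smul ((Lc : ℝ) ^ 8) (hW' μ y ν y'))
  exact ⟨_, _, _, half_pos (half_pos hm), hV'', hW''⟩

end Families

/-! ## §2 THE DEPTH-1 ANCHOR ROW AT THE RECORD, FOR ANY STEP WEIGHT -/

section Anchor

variable (Lc : ℕ) [NeZero Lc] (hLc : Odd Lc) (N : ℕ) (cΛ cB : ℝ) (Pn : Pins) (uF : ℕ → ℝ) (w : ℕ → EKer (3 + 1))
  (hwloc : ∀ j : ℕ, ∃ δ C : ℝ, 0 < δ ∧ 0 ≤ C ∧ ∀ (κ l : Fin (3 + 1)) (p : Fin (3 + 1) → ℤ), |w j κ l p| ≤ C * Real.exp (-δ * l1 p))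

include hwloc in
/-- [folklore] **THE DEPTH-1 ANCHOR ROW FOR ANY STEP WEIGHT** — `TowerFAnchorRow.hF₁_rec` (v10's `hF₁` under its σ at `AF 1 := σ₀•GcombSh Lc 0`) with `wStep Lc 1 ↦ w 0`
in `𝒱F 1 ∕ 𝒲F 1` AND on the right (`dressedEntry (w 0) (TshotOf … 1)`); option (3a): at `w 0 := wFRec … 0` the END's `hF₁` follows by the displayed `hWT 0`. -/
theorem hF₁_rec_w (huF : uF 0 ≠ 0) : ∀ (μ ν : Fin 4) (z : Fin 4 → ℤ), hessKer (scaleK (Sum.elim (fun _ : Fin (3 + 1) => (1 : ℝ)) (fun _ : Fin (3 + 1) => (uF 0)⁻¹)) (Sum.elim (fun _ : Fin (3 + 1) => (1 : ℝ)) (fun _ : Fin (3 + 1) => (uF 0)⁻¹)) (GcombSh (d := 3) Lc 0)) (fun μ y => scaleK (Sum.elim (fun _ : Fin (3 + 1) => (1 : ℝ)) (fun _ : Fin (3 + 1) => (uF 0))) (Sum.elim (fun _ : Fin (3 + 1) => (1 : ℝ)) (fun _ : Fin (3 + 1) => (uF 0))) ((Lc : ℝ) ^ 4 • dressV Lc Lc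 (w 0) (vertexOfK (GcombSh (d := 3) Lc 0) Lc (JsB12CombSh0 hLc N (symTablesAn1S2 3 Lc cΛ) cΛ cB 0).S) μ y)) (fun μ y ν y' => scaleK (Sum.elim (fun _ : Fin (3 + 1) => (1 : ℝ)) (fun _ : Fin (3 + 1) => (uF 0))) (Sum.elim (fun _ : Fin (3 + 1) => (1 : ℝ)) (fun _ : Fin (3 + 1) => (uF 0))) ((Lc : ℝ) ^ 8 • dressW Lc Lc (w 0) (JsB12CombSh0 hLc N (symTablesAn1S2 3 Lc cΛ) cΛ cB 0).W μ y ν y')) μ ν z = (Lc : ℝ) ^ 8 * dressedEntry (w 0) (TshotOf Lc (JcComp hLc N cΛ cB (Roots.ctr Lc) Pn) 1) ((Lc : ℤ) • z) μ ν := by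
  intro μ ν z
  have hσσ : ∀ a : Fib 3, Sum.elim (fun _ : Fin (3 + 1) => (1 : ℝ)) (fun _ : Fin (3 + 1) => (uF 0)⁻¹) a
      * Sum.elim (fun _ : Fin (3 + 1) => (1 : ℝ)) (fun _ : Fin (3 + 1) => (uF 0)) a = 1 := fun a => fibreScale_mul_inv huF a
  rw [hessKer_scaleK _ _ hσσ (GcombSh (d := 3) Lc 0)
    (fun μ y => (Lc : ℝ) ^ 4 • dressV Lc Lc (w 0) (vertexOfK (GcombSh (d := 3) Lc 0) Lc (JsB12CombSh0 hLc N (symTablesAn1S2 3 Lc cΛ) cΛ cB 0).S) μ y)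
    (fun μ y ν y' => (Lc : ℝ) ^ 8 • dressW Lc Lc (w 0) (JsB12CombSh0 hLc N (symTablesAn1S2 3 Lc cΛ) cΛ cB 0).W μ y ν y')]
  rw [TshotOf_JcComp_one, TbalOf_JsB12CombShSym]
  -- the literal's letters
  obtain ⟨δA, CA, hδA, -, hA⟩ := decays_GcombSh (d := 3) Lc 0
  obtain ⟨Cv, Cw, δ, hδ, hV, hW⟩ := vertexFamilies_G0 Lc hLc N cΛ cB
  obtain ⟨δw, Cw0, hδw, hCw0, hw⟩ := hwloc 0
  have hid := hessKer_dressV_dressW (N := Lc) Lc (w := w 0) (A := GcombSh (d := 3) Lc 0)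
    (V := vertexOfK (GcombSh (d := 3) Lc 0) Lc (JsB12CombSh0 hLc N (symTablesAn1S2 3 Lc cΛ) cΛ cB 0).S)
    (W := (JsB12CombSh0 hLc N (symTablesAn1S2 3 Lc cΛ) cΛ cB 0).W) ⟨CA, δA, hδA, hA⟩ (fun s => shiftK_GcombSh' (d := 3) 0 s)
    (fun c a u => hw c a u) hCw0 hδw hV hW hδ (VG0_translate Lc hLc N cΛ cB)
    (fun c t e t' s => JsB12CombSh0_W_translate hLc N (symTablesAn1S2 3 Lc cΛ) cΛ cB 0 c t e t' s) μ ν z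
  rw [← hid]
  simp only [ExpKernelCalculus.hessKer]
  rw [tadpole_smul, bubble_smul_left, bubble_smul_right]
  ring

end Anchor

end Summit.QuantumFields.BalabanUV.Beta.FP.TowerFAnchorRowW

end
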